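import Mathlib.Analysis.Calculus.MeanValue
import Mathlib.Topology.Order.IntermediateValue
import Summits.Ventures.CertifiedManyBodySolver.Downfold.CoexistencePressureBracket
import HarnessLib

/-!
# The static coexistence pressure of two phases from finitely many relaxations, II:
# the contrast-band bracket and the rows of record

Venture CertifiedManyBodySolver, cell `pub/hubbard-downfold` (S1 = ROUTER), seat hubbard-downfold-tool-2;
namespace `Summit.Ventures.CertifiedManyBodySolver.Downfold.StructFlag`. Companion of
`CoexistencePressureBracket` (§1 one phase: Le Chatelier, concave / Lipschitz minimal enthalpy; §2
two phases: increment sandwich, ENTHALPY–VOLUME CONSISTENCY TEST, the assumption-free TWO-POINT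
COEXISTENCE BRACKET). Here:

* §2b UNIQUENESS AND EXISTENCE on a window `[P_a, P_b]` carrying relaxations of both phases at every
  pressure: with positive minimal contrast `d = V₁(P_b) - V₂(P_a)` the difference `ΔH` is strictly
  decreasing (`deltaH_strictAntiOn`) and the coexistence pressure is unique (`coexistence_unique`);
  it exists by the intermediate value theorem, both minimal enthalpies being continuous
  (`exists_coexistence`). [folklore]

* §3 THE CONTRAST-BAND BRACKET (a SCREENING hypothesis made explicit): if `ΔH` is differentiable on
  `(P_a, P_b)` with `-c_hi ≤ ΔH' ≤ -c_lo`, `0 < c_lo ≤ c_hi` (the same-pressure volume contrast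
  stays in a stated band), then `P_a + h_a/c_hi ≤ P* ≤ P_a + h_a/c_lo` and
  `P_b - h_b/c_lo ≤ P* ≤ P_b - h_b/c_hi` (`coexistence_mem_Icc_of_deriv_band`) — the «linear
  interpolation» of the files of record is the case `c_lo = c_hi`.
* §4 ROWS OF RECORD (tool-2 STRUCT-COMPARATOR-FeSe-highP.md v1.1 §2, static NM PBE, per FeSe;
  STRUCT-COMPARATOR-hydrides.md v1.3 §2.5, per LaH₁₀ f.u.; pressures converted by the exact SI
  factor `κ = 1 GPa·Å³ / meV = 5·10⁹ / 801088317 ≈ 6.2415`): the FeSe tetragonal/Pnma relax pairs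
  (4, 8) and (8, 12) GPa PASS the consistency test (`fese_nm_pairs_consistent`); the pair (8, 12)
  certifies `P* ∈ [9.79, 10.41] GPa` (`fese_nm_coexistence_window`; the file's «≈ 10.1» sits
  inside); the LaH₁₀ C2/m vs Fm-3m pair (200, 250) GPa certifies only `P* ∈ [201, 249.7]`
  assumption-free (`lah10_coexistence_window`: the 0.1–0.3 % volume contrast is swamped by
  compression) and `[228.4, 241.9]` under the contrast band `[0.035, 0.092] Å³/f.u.` of the two
  computed points (`lah10_coexistence_window_of_band`) — so the «≈ 237 GPa» of record is an
  EXTRAPOLATED-class number, now labelled as such.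

Everything is PROVED. WHAT THIS IS NOT: a transition pressure of FeSe or LaH₁₀ — the six volumes and
two enthalpy differences per row are SCREENING-GRADE static-PBE numbers entered as hypotheses; the
theorems certify only «these relaxations ⇒ this window for the static crossing of these two
structures».
-/

open Set

namespace Summit.Ventures.CertifiedManyBodySolver.Downfold.StructFlag

open Literature.MathematicalPhysics.StatisticalMechanics (enthalpy)

/-! ## §2b Uniqueness and existence of the coexistence pressure on a window -/

/-- **Strict decrease of the enthalpy difference on a window with positive minimal contrast.**
With relaxation families `v₁`, `v₂` of the two phases on `[P_a, P_b]` and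
`d = v₁(P_b) - v₂(P_a) > 0`, the difference `ΔH = H₂ - H₁` is strictly decreasing on `[P_a, P_b]`
(its increments are at most `-(q - p)·d`). [folklore] -/
theorem deltaH_strictAntiOn {E₁ E₂ : ℝ → ℝ} {S₁ S₂ : Set ℝ} {v₁ v₂ : ℝ → ℝ} {P_a P_b : ℝ}
    (hS₁ : ∀ P ∈ Icc P_a P_b, v₁ P ∈ S₁) (hmin₁ : ∀ P ∈ Icc P_a P_b, IsMinOn (enthalpy E₁ P) S₁ (v₁ P))
    (hS₂ : ∀ P ∈ Icc P_a P_b, v₂ P ∈ S₂) (hmin₂ : ∀ P ∈ Icc P_a P_b, IsMinOn (enthalpy E₂ P) S₂ (v₂ P))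
    (hd : 0 < v₁ P_b - v₂ P_a) :
    StrictAntiOn (fun P => enthalpy E₂ P (v₂ P) - enthalpy E₁ P (v₁ P)) (Icc P_a P_b) := by
  intro p hp q hq hpq
  have hab : P_a ≤ P_b := hp.1.trans hp.2
  obtain ⟨-, up⟩ := deltaH_sub_mem_Icc (hmin₁ p hp) (hmin₁ q hq) (hmin₂ p hp) (hmin₂ q hq)
    (hS₁ p hp) (hS₁ q hq) (hS₂ p hp) (hS₂ q hq)
  have hv₂ : v₂ p ≤ v₂ P_a := antitoneOn_volume hS₂ hmin₂ (left_mem_Icc.2 hab) hp hp.1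
  have hv₁ : v₁ P_b ≤ v₁ q := antitoneOn_volume hS₁ hmin₁ hq (right_mem_Icc.2 hab) hq.2
  have hneg : (q - p) * (v₂ p - v₁ q) < 0 :=
    mul_neg_of_pos_of_neg (sub_pos.mpr hpq) (by linarith)
  show enthalpy E₂ q (v₂ q) - enthalpy E₁ q (v₁ q) < enthalpy E₂ p (v₂ p) - enthalpy E₁ p (v₁ p)
  linarith

/-- **Uniqueness of the coexistence pressure** on a window with positive minimal contrast: two
pressures of `[P_a, P_b]` at which the minimal enthalpies of the two phases coincide are equal.
[folklore] -/
theorem coexistence_unique {E₁ E₂ : ℝ → ℝ} {S₁ S₂ : Set ℝ} {v₁ v₂ : ℝ → ℝ} {P_a P_b P P' : ℝ}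
    (hS₁ : ∀ P ∈ Icc P_a P_b, v₁ P ∈ S₁) (hmin₁ : ∀ P ∈ Icc P_a P_b, IsMinOn (enthalpy E₁ P) S₁ (v₁ P))
    (hS₂ : ∀ P ∈ Icc P_a P_b, v₂ P ∈ S₂) (hmin₂ : ∀ P ∈ Icc P_a P_b, IsMinOn (enthalpy E₂ P) S₂ (v₂ P))
    (hd : 0 < v₁ P_b - v₂ P_a) (hP : P ∈ Icc P_a P_b) (hP' : P' ∈ Icc P_a P_b)
    (hz : enthalpy E₂ P (v₂ P) = enthalpy E₁ P (v₁ P))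
    (hz' : enthalpy E₂ P' (v₂ P') = enthalpy E₁ P' (v₁ P')) : P = P' := by
  have hanti := deltaH_strictAntiOn hS₁ hmin₁ hS₂ hmin₂ hd
  have e : (fun P => enthalpy E₂ P (v₂ P) - enthalpy E₁ P (v₁ P)) P =
      (fun P => enthalpy E₂ P (v₂ P) - enthalpy E₁ P (v₁ P)) P' := by
    simp only [hz, hz', sub_self]
  exact (hanti.injOn).eq_iff hP hP' |>.mp e

/-- **Existence of a coexistence pressure (intermediate value theorem).** If both phases have
relaxed volumes at every pressure of `[P_a, P_b]`, phase 1 is not higher at `P_a` and phase 2 is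
not higher at `P_b`, the minimal enthalpies coincide at some `P* ∈ [P_a, P_b]` (both minimal
enthalpies are continuous, §1). [folklore] -/
theorem exists_coexistence {E₁ E₂ : ℝ → ℝ} {S₁ S₂ : Set ℝ} {v₁ v₂ : ℝ → ℝ} {P_a P_b : ℝ}
    (hab : P_a ≤ P_b)
    (hS₁ : ∀ P ∈ Icc P_a P_b, v₁ P ∈ S₁) (hmin₁ : ∀ P ∈ Icc P_a P_b, IsMinOn (enthalpy E₁ P) S₁ (v₁ P))
    (hS₂ : ∀ P ∈ Icc P_a P_b, v₂ P ∈ S₂) (hmin₂ : ∀ P ∈ Icc P_a P_b, IsMinOn (enthalpy E₂ P) S₂ (v₂ P))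
    (ha : enthalpy E₁ P_a (v₁ P_a) ≤ enthalpy E₂ P_a (v₂ P_a))
    (hb : enthalpy E₂ P_b (v₂ P_b) ≤ enthalpy E₁ P_b (v₁ P_b)) :
    ∃ P ∈ Icc P_a P_b, enthalpy E₂ P (v₂ P) = enthalpy E₁ P (v₁ P) := by
  have hcont : ContinuousOn (fun P => enthalpy E₂ P (v₂ P) - enthalpy E₁ P (v₁ P)) (Icc P_a P_b) :=
    (continuousOn_minEnthalpy hS₂ hmin₂).sub (continuousOn_minEnthalpy hS₁ hmin₁)
  have h0 : (0 : ℝ) ∈ Icc (enthalpy E₂ P_b (v₂ P_b) - enthalpy E₁ P_b (v₁ P_b))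
      (enthalpy E₂ P_a (v₂ P_a) - enthalpy E₁ P_a (v₁ P_a)) :=
    ⟨by linarith, by linarith⟩
  obtain ⟨P, hP, hP0⟩ := intermediate_value_Icc' hab hcont h0
  exact ⟨P, hP, by simpa [sub_eq_zero] using hP0⟩

/-! ## §3 The contrast-band bracket (the screening hypothesis behind «linear interpolation») -/

/-- **Coexistence bracket under a stated band for the volume contrast.** If the enthalpy
difference `f = ΔH` is continuous on `[P_a, P_b]`, differentiable inside with
`-c_hi ≤ f' ≤ -c_lo` for some `0 < c_lo ≤ c_hi` (a declared band for the same-pressure volume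
contrast `V₁ - V₂`, when `Hᵢ' = Vᵢ`), and `f(P_a) = h_a`, `f(P*) = 0`, `f(P_b) = -h_b` with
`P_a ≤ P* ≤ P_b`, then
`max (P_a + h_a/c_hi) (P_b - h_b/c_lo) ≤ P* ≤ min (P_a + h_a/c_lo) (P_b - h_b/c_hi)`.
The two bounds coincide with the linear-interpolation point when `c_lo = c_hi`. [folklore]
(mean value inequalities, Mathlib `Convex.mul_sub_le_image_sub_of_le_deriv` /
`Convex.image_sub_le_mul_sub_of_deriv_le`) -/
theorem coexistence_mem_Icc_of_deriv_band {f f' : ℝ → ℝ} {P_a P_s P_b h_a h_b c_lo c_hi : ℝ}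
    (hcont : ContinuousOn f (Icc P_a P_b)) (hder : ∀ x ∈ Ioo P_a P_b, HasDerivAt f (f' x) x)
    (hband : ∀ x ∈ Ioo P_a P_b, f' x ∈ Icc (-c_hi) (-c_lo)) (hc : 0 < c_lo) (hcc : c_lo ≤ c_hi)
    (has : P_a ≤ P_s) (hsb : P_s ≤ P_b) (hfa : f P_a = h_a) (hfs : f P_s = 0)
    (hfb : f P_b = -h_b) :
    P_s ∈ Icc (max (P_a + h_a / c_hi) (P_b - h_b / c_lo))
      (min (P_a + h_a / c_lo) (P_b - h_b / c_hi)) := by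
  have hchi : 0 < c_hi := hc.trans_le hcc
  have hdiff : DifferentiableOn ℝ f (interior (Icc P_a P_b)) := by
    rw [interior_Icc]; exact fun z hz => (hder z hz).differentiableAt.differentiableWithinAt
  have hge : ∀ z ∈ interior (Icc P_a P_b), -c_hi ≤ deriv f z := by
    rw [interior_Icc]; intro z hz; rw [(hder z hz).deriv]; exact (hband z hz).1
  have hle : ∀ z ∈ interior (Icc P_a P_b), deriv f z ≤ -c_lo := by
    rw [interior_Icc]; intro z hz; rw [(hder z hz).deriv]; exact (hband z hz).2
  have hab : P_a ≤ P_b := has.trans hsb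
  have hPa : P_a ∈ Icc P_a P_b := left_mem_Icc.2 hab
  have hPb : P_b ∈ Icc P_a P_b := right_mem_Icc.2 hab
  have hPs : P_s ∈ Icc P_a P_b := ⟨has, hsb⟩
  have cv : Convex ℝ (Icc P_a P_b) := convex_Icc P_a P_b
  have loA := cv.mul_sub_le_image_sub_of_le_deriv hcont hdiff hge P_a hPa P_s hPs has
  have hiA := cv.image_sub_le_mul_sub_of_deriv_le hcont hdiff hle P_a hPa P_s hPs has
  have loB := cv.mul_sub_le_image_sub_of_le_deriv hcont hdiff hge P_s hPs P_b hPb hsb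
  have hiB := cv.image_sub_le_mul_sub_of_deriv_le hcont hdiff hle P_s hPs P_b hPb hsb
  rw [hfs, hfa] at loA hiA
  rw [hfb, hfs] at loB hiB
  -- loA : -c_hi * (P_s - P_a) ≤ 0 - h_a ; hiA : 0 - h_a ≤ -c_lo * (P_s - P_a)
  -- loB : -c_hi * (P_b - P_s) ≤ -h_b - 0 ; hiB : -h_b - 0 ≤ -c_lo * (P_b - P_s)
  have a1 : h_a / c_hi ≤ P_s - P_a := by rw [div_le_iff₀ hchi]; linarith
  have a2 : P_s - P_a ≤ h_a / c_lo := by rw [le_div_iff₀ hc]; linarith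
  have b1 : h_b / c_hi ≤ P_b - P_s := by rw [div_le_iff₀ hchi]; linarith
  have b2 : P_b - P_s ≤ h_b / c_lo := by rw [le_div_iff₀ hc]; linarith
  constructor
  · exact max_le (by linarith) (by linarith)
  · exact le_min (by linarith) (by linarith)

/-! ## §4 Rows of record (tool-2 STRUCT-COMPARATOR files; SCREENING-GRADE inputs as hypotheses)

Units: volumes in `Å³` per formula unit, enthalpy differences in `meV` per formula unit, pressures
in `GPa` converted by the EXACT SI factor `κ = 1 GPa·Å³ / 1 meV = 10⁻²¹ J / (1.602176634·10⁻²² J)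
= 5·10⁹ / 801088317 ≈ 6.2415` [folklore] (SI 2019 exact elementary charge). -/

/-- **FeSe #26, static NM PBE, tetragonal P4/nmm (phase 1) vs Pnma MnP-type (phase 2), pair
(8, 12) GPa — the coexistence window.** Inputs (STRUCT-COMPARATOR-FeSe-highP.md v1.1 §2 table, per
FeSe): `V_tet(8) = 32.667`, `V_tet(12) = 31.253`, `V_Pnma(8) = 26.734`, `V_Pnma(12) = 26.172 Å³`;
`ΔH(8) = +72.6`, `ΔH(12) = -64.5 meV`. Conclusion: any static coexistence pressure of these two
structures between the computed points satisfies `9.79 ≤ P* ≤ 10.41 GPa` (maximal contrast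
`D = 6.495 Å³` gives `[9.790, 10.409]`; the minimal contrast `d = 4.519 Å³ > 0` gives the weaker
`[9.713, 10.574]` and uniqueness). The file's «≈ 10.1 GPa by linear interpolation» lies inside.
WHAT THIS IS NOT: a transition pressure of FeSe (printed onsets by source [6.2, 12.5] GPa; the
spin-polarised pair is not bracketed — one point only). [folklore] -/
theorem fese_nm_coexistence_window {E₁ E₂ : ℝ → ℝ} {S₁ S₂ : Set ℝ} {κ P_s u_s w_s : ℝ}
    (hκ : κ = 5000000000 / 801088317)
    (h1a : IsMinOn (enthalpy E₁ (8 * κ)) S₁ 32.667) (h1s : IsMinOn (enthalpy E₁ (P_s * κ)) S₁ u_s)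
    (h1b : IsMinOn (enthalpy E₁ (12 * κ)) S₁ 31.253)
    (h2a : IsMinOn (enthalpy E₂ (8 * κ)) S₂ 26.734) (h2s : IsMinOn (enthalpy E₂ (P_s * κ)) S₂ w_s)
    (h2b : IsMinOn (enthalpy E₂ (12 * κ)) S₂ 26.172)
    (hu_a : (32.667 : ℝ) ∈ S₁) (hu_s : u_s ∈ S₁) (hu_b : (31.253 : ℝ) ∈ S₁)
    (hw_a : (26.734 : ℝ) ∈ S₂) (hw_s : w_s ∈ S₂) (hw_b : (26.172 : ℝ) ∈ S₂)
    (has : 8 ≤ P_s) (hsb : P_s ≤ 12)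
    (hΔa : enthalpy E₂ (8 * κ) 26.734 - enthalpy E₁ (8 * κ) 32.667 = 72.6)
    (hΔb : enthalpy E₂ (12 * κ) 26.172 - enthalpy E₁ (12 * κ) 31.253 = -64.5)
    (hzero : enthalpy E₂ (P_s * κ) w_s = enthalpy E₁ (P_s * κ) u_s) :
    P_s ∈ Icc (9.79 : ℝ) 10.41 := by
  have hκpos : 0 < κ := by rw [hκ]; norm_num
  have has' : 8 * κ ≤ P_s * κ := mul_le_mul_of_nonneg_right has hκpos.le
  have hsb' : P_s * κ ≤ 12 * κ := mul_le_mul_of_nonneg_right hsb hκpos.le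
  obtain ⟨lo, hi⟩ := coexistence_mem_Icc_of_maxContrast h1a h1s h1b h2a h2s h2b hu_a hu_s hu_b
    hw_a hw_s hw_b has' hsb' hΔa.symm (by norm_num) (h_b := 64.5) (by linarith) (by norm_num) hzero
    (D := 32.667 - 26.172) rfl
  rw [hκ] at lo hi
  norm_num at lo hi
  exact ⟨by linarith, by linarith⟩

/-- **FeSe #26, static NM PBE — the two relax pairs pass the ENTHALPY–VOLUME CONSISTENCY TEST**
(`contrast_window_of_pair` evaluated on the data): pair (4, 8) GPa with `ΔH(4) - ΔH(8) = 237.7 - 72.6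
= 165.1 meV`, `d = V_tet(8) - V_Pnma(4) = 32.667 - 27.373`, `D = V_tet(4) - V_Pnma(8) = 34.804 - 26.734`;
pair (8, 12) with `137.1 meV`, `d = 31.253 - 26.734`, `D = 32.667 - 26.172 Å³`: in both cases
`d·ΔP·κ ≤ drop ≤ D·ΔP·κ`. (Pure arithmetic; the four tetragonal/Pnma cells and three enthalpy
differences are therefore ADMISSIBLE as joint minima of two fixed `E(V)` curves — a necessary, not a
sufficient, check.) [folklore] -/
theorem fese_nm_pairs_consistent :
    ((32.667 - 27.373) * (8 - 4) * (5000000000 / 801088317 : ℝ) ≤ 237.7 - 72.6 ∧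
      (237.7 - 72.6 : ℝ) ≤ (34.804 - 26.734) * (8 - 4) * (5000000000 / 801088317)) ∧
    ((31.253 - 26.734) * (12 - 8) * (5000000000 / 801088317 : ℝ) ≤ 72.6 + 64.5 ∧
      (72.6 + 64.5 : ℝ) ≤ (32.667 - 26.172) * (12 - 8) * (5000000000 / 801088317)) := by
  norm_num

/-- **LaH₁₀, static PBE, C2/m (phase 1, lower at 200 GPa) vs Fm-3m (phase 2, lower at 250 GPa),
pair (200, 250) GPa — the ASSUMPTION-FREE window is nearly the whole interval.** Inputs
(STRUCT-COMPARATOR-hydrides.md v1.3 §2.5, per f.u.): `V_C2/m(200) = 30.642`, `V_C2/m(250) = 28.593`,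
`V_Fm-3m(200) = 30.550`, `V_Fm-3m(250) = 28.558 Å³`; `ΔH(Fm-3m - C2/m) = +14.0 (200) / -4.7 (250) meV`.
Conclusion: `201 ≤ P* ≤ 249.7 GPa` — the same-pressure volume contrast (0.1–0.3 %) is swamped by the
6.7 % compression between the points, so two relaxations 50 GPa apart do not locate the crossing by
the minimum principle alone (the minimal contrast `d` is negative: no uniqueness either).
WHAT THIS IS NOT: a statement about LaH₁₀ (quantum/anharmonic Fm-3m stabilisation is the print of
record; ROUTER §6). [folklore] -/
theorem lah10_coexistence_window {E₁ E₂ : ℝ → ℝ} {S₁ S₂ : Set ℝ} {κ P_s u_s w_s : ℝ}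
    (hκ : κ = 5000000000 / 801088317)
    (h1a : IsMinOn (enthalpy E₁ (200 * κ)) S₁ 30.642)
    (h1s : IsMinOn (enthalpy E₁ (P_s * κ)) S₁ u_s)
    (h1b : IsMinOn (enthalpy E₁ (250 * κ)) S₁ 28.593)
    (h2a : IsMinOn (enthalpy E₂ (200 * κ)) S₂ 30.550)
    (h2s : IsMinOn (enthalpy E₂ (P_s * κ)) S₂ w_s)
    (h2b : IsMinOn (enthalpy E₂ (250 * κ)) S₂ 28.558)
    (hu_a : (30.642 : ℝ) ∈ S₁) (hu_s : u_s ∈ S₁) (hu_b : (28.593 : ℝ) ∈ S₁)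
    (hw_a : (30.550 : ℝ) ∈ S₂) (hw_s : w_s ∈ S₂) (hw_b : (28.558 : ℝ) ∈ S₂)
    (has : 200 ≤ P_s) (hsb : P_s ≤ 250)
    (hΔa : enthalpy E₂ (200 * κ) 30.550 - enthalpy E₁ (200 * κ) 30.642 = 14.0)
    (hΔb : enthalpy E₂ (250 * κ) 28.558 - enthalpy E₁ (250 * κ) 28.593 = -4.7)
    (hzero : enthalpy E₂ (P_s * κ) w_s = enthalpy E₁ (P_s * κ) u_s) :
    P_s ∈ Icc (201 : ℝ) 249.7 := by
  have hκpos : 0 < κ := by rw [hκ]; norm_num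
  have has' : 200 * κ ≤ P_s * κ := mul_le_mul_of_nonneg_right has hκpos.le
  have hsb' : P_s * κ ≤ 250 * κ := mul_le_mul_of_nonneg_right hsb hκpos.le
  obtain ⟨lo, hi⟩ := coexistence_mem_Icc_of_maxContrast h1a h1s h1b h2a h2s h2b hu_a hu_s hu_b
    hw_a hw_s hw_b has' hsb' hΔa.symm (by norm_num) (h_b := 4.7) (by linarith) (by norm_num) hzero
    (D := 30.642 - 28.558) rfl
  rw [hκ] at lo hi
  norm_num at lo hi
  exact ⟨by linarith, by linarith⟩

/-- **LaH₁₀ (200, 250) GPa under the CONTRAST BAND of the two computed points** (a SCREENING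
hypothesis made explicit): if the static enthalpy difference `ΔH(P)` (meV/f.u., `P` in GPa) is
differentiable between the points with slope in `[-0.092·κ, -0.035·κ]` meV/GPa — i.e. the
same-pressure volume contrast `V_C2/m - V_Fm-3m` stays inside the hull `[0.035, 0.092] Å³/f.u.` of its
two computed values (`30.642 - 30.550`, `28.593 - 28.558`) — then `228.4 ≤ P* ≤ 241.9 GPa`. The
«≈ 237 GPa by linear interpolation» of record sits inside and is therefore an EXTRAPOLATED-class
number: it rests on this band, not on the two relaxations alone (`lah10_coexistence_window`).
[folklore] -/
theorem lah10_coexistence_window_of_band {f f' : ℝ → ℝ} {κ P_s : ℝ}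
    (hκ : κ = 5000000000 / 801088317)
    (hcont : ContinuousOn f (Icc 200 250)) (hder : ∀ x ∈ Ioo (200 : ℝ) 250, HasDerivAt f (f' x) x)
    (hband : ∀ x ∈ Ioo (200 : ℝ) 250, f' x ∈ Icc (-(0.092 * κ)) (-(0.035 * κ)))
    (has : 200 ≤ P_s) (hsb : P_s ≤ 250) (hfa : f 200 = 14.0) (hfs : f P_s = 0)
    (hfb : f 250 = -4.7) : P_s ∈ Icc (228.4 : ℝ) 241.9 := by
  have hκpos : 0 < κ := by rw [hκ]; norm_num
  obtain ⟨lo, hi⟩ := coexistence_mem_Icc_of_deriv_band hcont hder hband (by positivity)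
    (by nlinarith) has hsb hfa hfs (h_b := 4.7) hfb
  have lo' := (le_max_right _ _).trans lo
  have hi' := hi.trans (min_le_right _ _)
  rw [hκ] at lo' hi'
  norm_num at lo' hi'
  exact ⟨by linarith, by linarith⟩

end Summit.Ventures.CertifiedManyBodySolver.Downfold.StructFlag
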